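import Summits.CriticalPhenomena.PercolationContinuityZ3.Theorems.PercNearOneGluingNoHeavyLowerTailThreePointProductFormFibreTwoClusterFlip
import Summits.CriticalPhenomena.PercolationContinuityZ3.Theorems.PercNearOneGluingNoHeavyLowerTailThreePointProductFormFibreHanging
import HarnessLib

/-!
# The product form `#bad² ≤ #P1·#P2` in the fibre language: LOCALITY ACROSS A TWO-VERTEX SEPARATOR
# (Sahi programme, prover prim-sahi-p2 gen 55)

Support file (`--supports stmt-CriticalPhenomena-4575`, helper); first half of the formalisation of the TWO-TERMINAL SUBSTITUTION THEOREM (memo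
`run/shared/lean/prim/prim-sahi/FROM-prim-sahi-p2-gen55-REDUCTIONS.md` §0(0), §3; reduction R4).  Standard axioms, no sorries, no named facts, no definitions.

SETTING.  A finite multigraph `(V, α, ends)`; a vertex set `Nv` (the INTERIOR of a two-terminal network `N`) and two PORTS `p, q ∉ Nv`; the labels are
classified by `inN` into the network's labels (`hN1`: endpoints in `Nv ∪ {p, q}`) and the rest (`hN2`: endpoints outside `Nv`).  For a configuration
`z` the statements speak about two auxiliary configurations given by hypotheses (no `if`-terms in statements): the NETWORK PART `zn` (`= z` on the
network labels, closed elsewhere) and the REST PART `zr` (`= z` on the rest, closed on the network).  Write `R w x y` for open connection.  The network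
enters the rest's connectivity only through the VIRTUAL EDGE `ε := R zn p q`, used at most once:
  `Rv(zr, zn; u, v) :≡ R zr u v ∨ (R zn p q ∧ ((R zr u p ∧ R zr q v) ∨ (R zr u q ∧ R zr p v)))`.
* `reachable_of_reachable_part` [this work] — connections of `zn` or of `zr` are connections of `z`.
* **`reachable_twoPort_iff`** [this work] — for `u, v ∉ Nv`: `R z u v ↔ Rv(zr, zn; u, v)` (walk surgery: an excursion into the network enters and leaves
  through ports; a return to the same port is cut out, a crossing is the virtual edge; `twoPort_walk` is the induction).
* `reachable_into_iff` [this work] — for `u ∉ Nv`, `v ∈ Nv`: `R z u v ↔ ∃ t ∈ {p, q}, R z u t ∧ R zn t v` (the last port on the way in).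
* **`flat_apply_rest`**, **`flat_apply_net`** [this work] — the flat `♭ₐz = clusterFlip ends a z̄` of an apex `a ∉ Nv`: on a rest label it is
  determined by `(zr, ε)` (`flat_rest_eq_of_agree`); on a network label `l` it complements `z l` iff `l` touches `⋃ {C^{zn}_t : t ∈ {p,q}, R z a t}` —
  i.e. the network part of `♭ₐz` is `zn` flipped around the clusters of those ports that lie in the apex cluster (none / one = `clusterFlip` / both =
  the two-cluster flip of `…FibreTwoClusterFlip`).
[folklore] (walks through a separator); [cite: Gladkov2024, Conjecture 10.1 (p. 18), arXiv:2408.08457] for CONJECTURE (P).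
-/

namespace Summit.CriticalPhenomena.PercolationContinuityZ3.Theorems.ProductFormFibre

open Finset Literature.Probability.Percolation
open Summit.CriticalPhenomena.PercolationContinuityZ3.Theorems.ThreePointCPIClusterSwap
  (CReach QTouch clusterFlip clusterFlip_of_qtouch clusterFlip_of_not_qtouch)

variable {V α : Type*}

section TwoPort

variable (ends : α → Sym2 V) (p q : V) (Nv : Set V) (inN : α → Prop)
  (hN1 : ∀ l, inN l → ∀ v ∈ ends l, v ∈ Nv ∨ v = p ∨ v = q) (hN2 : ∀ l, ¬ inN l → ∀ v ∈ ends l, v ∉ Nv)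
  {z zn zr : α → Bool}
  (hzn : ∀ l, inN l → zn l = z l) (hzn0 : ∀ l, ¬ inN l → zn l = false)
  (hzr : ∀ l, ¬ inN l → zr l = z l) (hzr0 : ∀ l, inN l → zr l = false)

/-! ### 1. Parts and single steps -/

/-- A configuration below `z` (every open label of `w` is open in `z`) has fewer connections. [folklore] -/
theorem reachable_of_le {w z : α → Bool} (hle : ∀ l, w l = true → z l = true) {u v : V}
    (h : (openGraph (labelledOpen ends w)).Reachable u v) : (openGraph (labelledOpen ends z)).Reachable u v := by
  refine h.mono fun x y hxy => ?_
  rw [openGraph_adj] at hxy ⊢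
  obtain ⟨⟨l, hl, hle'⟩, hne⟩ := hxy
  exact ⟨⟨l, hle l hl, hle'⟩, hne⟩

include hzn hzn0 in
/-- Connections of the network part are connections of `z`. [this work] -/
theorem reachable_of_reachable_net {u v : V} (h : (openGraph (labelledOpen ends zn)).Reachable u v) :
    (openGraph (labelledOpen ends z)).Reachable u v := by
  refine reachable_of_le ends (fun l hl => ?_) h
  by_cases hin : inN l
  · rw [← hzn l hin]; exact hl
  · rw [hzn0 l hin] at hl; exact absurd hl Bool.false_ne_true

include hzr hzr0 in
/-- Connections of the rest part are connections of `z`. [this work] -/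
theorem reachable_of_reachable_rest {u v : V} (h : (openGraph (labelledOpen ends zr)).Reachable u v) :
    (openGraph (labelledOpen ends z)).Reachable u v := by
  refine reachable_of_le ends (fun l hl => ?_) h
  by_cases hin : inN l
  · rw [hzr0 l hin] at hl; exact absurd hl Bool.false_ne_true
  · rw [← hzr l hin]; exact hl

include hN2 in
/-- A label with an endpoint in the interior `Nv` is a network label. [this work] -/
theorem inN_of_mem {l : α} {v : V} (hv : v ∈ ends l) (hvN : v ∈ Nv) : inN l := by
  by_contra hin
  exact hN2 l hin v hv hvN

include hzn hzr in
/-- **One open step of `z`** between `u` and `w` is a step of the rest part (rest label) or of the network part (network label). [this work] -/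
theorem step_cases {u w : V} (hadj : (openGraph (labelledOpen ends z)).Adj u w) :
    (∃ l, ¬ inN l ∧ ends l = s(u, w) ∧ (openGraph (labelledOpen ends zr)).Adj u w) ∨
    (∃ l, inN l ∧ ends l = s(u, w) ∧ (openGraph (labelledOpen ends zn)).Adj u w) := by
  rw [openGraph_adj] at hadj
  obtain ⟨⟨l, hl, hle⟩, hne⟩ := hadj
  by_cases hin : inN l
  · right
    refine ⟨l, hin, hle, ?_⟩
    rw [openGraph_adj]
    exact ⟨⟨l, by rw [hzn l hin]; exact hl, hle⟩, hne⟩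
  · left
    refine ⟨l, hin, hle, ?_⟩
    rw [openGraph_adj]
    exact ⟨⟨l, by rw [hzr l hin]; exact hl, hle⟩, hne⟩

/-! ### 2. Walk surgery through the two ports -/

include hN1 hN2 hzn hzr in
/-- **Walk surgery.**  Along an open walk of `z` ending outside `Nv`: from a start outside `Nv` the end is reached in the rest part with at most one
use of the virtual edge; from a start inside `Nv` entered from the port `t` (`R zn t u`), the same holds from `t`. [this work] -/
theorem twoPort_walk {u v : V} (W : (openGraph (labelledOpen ends z)).Walk u v) (hv : v ∉ Nv) :
    (u ∉ Nv →
      ((openGraph (labelledOpen ends zr)).Reachable u v ∨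
        ((openGraph (labelledOpen ends zn)).Reachable p q ∧
          (((openGraph (labelledOpen ends zr)).Reachable u p ∧ (openGraph (labelledOpen ends zr)).Reachable q v) ∨
            ((openGraph (labelledOpen ends zr)).Reachable u q ∧ (openGraph (labelledOpen ends zr)).Reachable p v))))) ∧
    (u ∈ Nv → ∀ t, (t = p ∨ t = q) → (openGraph (labelledOpen ends zn)).Reachable t u →
      ((openGraph (labelledOpen ends zr)).Reachable t v ∨
        ((openGraph (labelledOpen ends zn)).Reachable p q ∧
          (((openGraph (labelledOpen ends zr)).Reachable t p ∧ (openGraph (labelledOpen ends zr)).Reachable q v) ∨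
            ((openGraph (labelledOpen ends zr)).Reachable t q ∧ (openGraph (labelledOpen ends zr)).Reachable p v))))) := by
  induction W with
  | nil => exact ⟨fun _ => Or.inl (SimpleGraph.Reachable.refl _), fun hu => absurd hu hv⟩
  | @cons u w v' hadj W ih =>
    obtain ⟨ih1, ih2⟩ := ih hv
    -- a port-to-port network connection from `t` to `w` (both ports) yields the conclusion from `t`, given the conclusion from `w`
    have virt : ∀ t w : V, (t = p ∨ t = q) → (w = p ∨ w = q) → (openGraph (labelledOpen ends zn)).Reachable t w →
        ((openGraph (labelledOpen ends zr)).Reachable w v' ∨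
          ((openGraph (labelledOpen ends zn)).Reachable p q ∧
            (((openGraph (labelledOpen ends zr)).Reachable w p ∧ (openGraph (labelledOpen ends zr)).Reachable q v') ∨
              ((openGraph (labelledOpen ends zr)).Reachable w q ∧ (openGraph (labelledOpen ends zr)).Reachable p v')))) →
        ((openGraph (labelledOpen ends zr)).Reachable t v' ∨
          ((openGraph (labelledOpen ends zn)).Reachable p q ∧
            (((openGraph (labelledOpen ends zr)).Reachable t p ∧ (openGraph (labelledOpen ends zr)).Reachable q v') ∨
              ((openGraph (labelledOpen ends zr)).Reachable t q ∧ (openGraph (labelledOpen ends zr)).Reachable p v')))) := by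
      intro t w ht hw htw hwv
      by_cases heq : t = w
      · subst heq; exact hwv
      -- `t ≠ w` are the two ports, so the network joins `p` and `q`
      have hpq : (openGraph (labelledOpen ends zn)).Reachable p q := by
        rcases ht with rfl | rfl <;> rcases hw with rfl | rfl
        · exact absurd rfl heq
        · exact htw
        · exact htw.symm
        · exact absurd rfl heq
      rcases hwv with hd | ⟨-, hx⟩
      · -- `w` reaches `v'` in the rest: use the virtual edge once
        right; refine ⟨hpq, ?_⟩
        rcases ht with rfl | rfl <;> rcases hw with rfl | rfl
        · exact absurd rfl heq
        · exact Or.inl ⟨SimpleGraph.Reachable.refl _, hd⟩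
        · exact Or.inr ⟨SimpleGraph.Reachable.refl _, hd⟩
        · exact absurd rfl heq
      · -- `w` already used the virtual edge: the two uses cancel or compose in the rest
        rcases ht with rfl | rfl <;> rcases hw with rfl | rfl
        · exact absurd rfl heq
        · rcases hx with ⟨h1, h2⟩ | ⟨-, h2⟩
          · exact Or.inr ⟨hpq, Or.inl ⟨SimpleGraph.Reachable.refl _, h2⟩⟩
          · exact Or.inl h2
        · rcases hx with ⟨-, h2⟩ | ⟨h1, h2⟩
          · exact Or.inl h2
          · exact Or.inr ⟨hpq, Or.inr ⟨SimpleGraph.Reachable.refl _, h2⟩⟩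
        · exact absurd rfl heq
    rcases step_cases ends inN hzn hzr hadj with ⟨l, hin, hle, hadj'⟩ | ⟨l, hin, hle, hadj'⟩
    · -- a rest step: both endpoints lie outside `Nv`
      have huN : u ∉ Nv := hN2 l hin u (by rw [hle]; exact Sym2.mem_mk_left u w)
      have hwN : w ∉ Nv := hN2 l hin w (by rw [hle]; exact Sym2.mem_mk_right u w)
      refine ⟨fun _ => ?_, fun hu => absurd hu huN⟩
      rcases ih1 hwN with hd | ⟨hpq, hx⟩
      · exact Or.inl (hadj'.reachable.trans hd)
      · right; refine ⟨hpq, ?_⟩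
        rcases hx with ⟨h1, h2⟩ | ⟨h1, h2⟩
        · exact Or.inl ⟨hadj'.reachable.trans h1, h2⟩
        · exact Or.inr ⟨hadj'.reachable.trans h1, h2⟩
    · -- a network step
      have huw : (openGraph (labelledOpen ends zn)).Reachable u w := hadj'.reachable
      refine ⟨fun huN => ?_, fun _ t ht htu => ?_⟩
      · -- `u` outside `Nv` on a network label: `u` is a port
        have hu : u = p ∨ u = q := by
          rcases hN1 l hin u (by rw [hle]; exact Sym2.mem_mk_left u w) with h | h
          · exact absurd h huN
          · exact h
        by_cases hwN : w ∈ Nv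
        · exact ih2 hwN u hu huw
        · have hw : w = p ∨ w = q := by
            rcases hN1 l hin w (by rw [hle]; exact Sym2.mem_mk_right u w) with h | h
            · exact absurd h hwN
            · exact h
          exact virt u w hu hw huw (ih1 hwN)
      · by_cases hwN : w ∈ Nv
        · exact ih2 hwN t ht (htu.trans huw)
        · have hw : w = p ∨ w = q := by
            rcases hN1 l hin w (by rw [hle]; exact Sym2.mem_mk_right u w) with h | h
            · exact absurd h hwN
            · exact h
          exact virt t w ht hw (htu.trans huw) (ih1 hwN)

include hN1 hN2 hzn hzn0 hzr hzr0 in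
/-- **CONNECTIONS OUTSIDE THE NETWORK'S INTERIOR see the network only through the virtual edge.**  For `u, v ∉ Nv`:
`R z u v ↔ R zr u v ∨ (R zn p q ∧ ((R zr u p ∧ R zr q v) ∨ (R zr u q ∧ R zr p v)))`. [this work] -/
theorem reachable_twoPort_iff {u v : V} (hu : u ∉ Nv) (hv : v ∉ Nv) :
    (openGraph (labelledOpen ends z)).Reachable u v ↔
      ((openGraph (labelledOpen ends zr)).Reachable u v ∨
        ((openGraph (labelledOpen ends zn)).Reachable p q ∧
          (((openGraph (labelledOpen ends zr)).Reachable u p ∧ (openGraph (labelledOpen ends zr)).Reachable q v) ∨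
            ((openGraph (labelledOpen ends zr)).Reachable u q ∧ (openGraph (labelledOpen ends zr)).Reachable p v)))) := by
  constructor
  · rintro ⟨W⟩
    exact (twoPort_walk ends p q Nv inN hN1 hN2 hzn hzr W hv).1 hu
  · have hR := fun {x y : V} (h : (openGraph (labelledOpen ends zr)).Reachable x y) =>
      reachable_of_reachable_rest ends inN hzr hzr0 h
    rintro (hd | ⟨hpq, ⟨h1, h2⟩ | ⟨h1, h2⟩⟩)
    · exact hR hd
    · exact ((hR h1).trans (reachable_of_reachable_net ends inN hzn hzn0 hpq)).trans (hR h2)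
    · exact ((hR h1).trans (reachable_of_reachable_net ends inN hzn hzn0 hpq).symm).trans (hR h2)

include hN1 hN2 hzn hzr in
/-- Along an open walk of `z` from a vertex of the interior `Nv` to a vertex outside it, the first exit is through a port `t`, reached inside
the network part. [this work] -/
theorem exists_port_of_walk {x y : V} (W : (openGraph (labelledOpen ends z)).Walk x y) (hy : y ∉ Nv) (hx : x ∈ Nv) :
    ∃ t, (t = p ∨ t = q) ∧ (openGraph (labelledOpen ends zn)).Reachable x t ∧ (openGraph (labelledOpen ends z)).Reachable t y := by
  induction W with
  | nil => exact absurd hx hy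
  | @cons x w y' hadj W ih =>
    rcases step_cases ends inN hzn hzr hadj with ⟨l, hin, hle, -⟩ | ⟨l, hin, hle, hadj'⟩
    · exact absurd hx (hN2 l hin x (by rw [hle]; exact Sym2.mem_mk_left x w))
    · by_cases hwN : w ∈ Nv
      · obtain ⟨t, ht, h1, h2⟩ := ih hy hwN
        exact ⟨t, ht, hadj'.reachable.trans h1, h2⟩
      · have hw : w = p ∨ w = q := by
          rcases hN1 l hin w (by rw [hle]; exact Sym2.mem_mk_right x w) with h | h
          · exact absurd h hwN
          · exact h
        exact ⟨w, hw, hadj'.reachable, ⟨W⟩⟩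

include hN1 hN2 hzn hzn0 hzr in
/-- **Connections INTO the interior pass through a port**: for `u ∉ Nv`, `v ∈ Nv`: `R z u v ↔ ∃ t ∈ {p,q}, R z u t ∧ R zn t v`. [this work] -/
theorem reachable_into_iff {u v : V} (hu : u ∉ Nv) (hv : v ∈ Nv) :
    (openGraph (labelledOpen ends z)).Reachable u v ↔
      ∃ t, (t = p ∨ t = q) ∧ (openGraph (labelledOpen ends z)).Reachable u t ∧ (openGraph (labelledOpen ends zn)).Reachable t v := by
  constructor
  · rintro ⟨W⟩
    obtain ⟨t, ht, h1, h2⟩ := exists_port_of_walk ends p q Nv inN hN1 hN2 hzn hzr W.reverse hu hv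
    exact ⟨t, ht, h2.symm, h1.symm⟩
  · rintro ⟨t, -, h1, h2⟩
    exact h1.trans (reachable_of_reachable_net ends inN hzn hzn0 h2)

/-! ### 3. The flat of an outside apex, label by label -/

include hN1 hN2 hzn hzn0 hzr hzr0 in
/-- **The flat on a REST label is determined by the rest part and the virtual edge.**  If `z, z'` have rest parts `zr, zr'` that agree, and
network parts with the same virtual edge (`R zn p q ↔ R zn' p q`), then for an apex `a ∉ Nv` the flats `♭ₐz, ♭ₐz'` agree on every rest label.
[this work] -/
theorem flat_rest_eq_of_agree {a : V} (ha : a ∉ Nv) {z' zn' zr' : α → Bool}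
    (hzn' : ∀ l, inN l → zn' l = z' l) (hzn0' : ∀ l, ¬ inN l → zn' l = false)
    (hzr' : ∀ l, ¬ inN l → zr' l = z' l) (hzr0' : ∀ l, inN l → zr' l = false)
    (hagree : ∀ l, ¬ inN l → z l = z' l)
    (hε : (openGraph (labelledOpen ends zn)).Reachable p q ↔ (openGraph (labelledOpen ends zn')).Reachable p q)
    {l : α} (hl : ¬ inN l) :
    clusterFlip ends a (fun x => !z x) l = clusterFlip ends a (fun x => !z' x) l := by
  classical
  have hrr : zr = zr' := by
    funext k
    by_cases hk : inN k
    · rw [hzr0 k hk, hzr0' k hk]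
    · rw [hzr k hk, hzr' k hk, hagree k hk]
  have hq : QTouch ends a (fun x => !z x) l ↔ QTouch ends a (fun x => !z' x) l := by
    rw [qtouch_compl_iff, qtouch_compl_iff]
    have key : ∀ v ∈ ends l, ((openGraph (labelledOpen ends z)).Reachable a v ↔ (openGraph (labelledOpen ends z')).Reachable a v) := by
      intro v hv
      have hvN : v ∉ Nv := hN2 l hl v hv
      rw [reachable_twoPort_iff ends p q Nv inN hN1 hN2 hzn hzn0 hzr hzr0 ha hvN,
        reachable_twoPort_iff ends p q Nv inN hN1 hN2 hzn' hzn0' hzr' hzr0' ha hvN, hrr, hε]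
    constructor
    · rintro ⟨v, hv, hr⟩; exact ⟨v, hv, (key v hv).1 hr⟩
    · rintro ⟨v, hv, hr⟩; exact ⟨v, hv, (key v hv).2 hr⟩
  by_cases h : QTouch ends a (fun x => !z x) l
  · rw [clusterFlip_of_qtouch ends a _ h, clusterFlip_of_qtouch ends a _ (hq.1 h)]
    simp only [hagree l hl]
  · rw [clusterFlip_of_not_qtouch ends a _ h, clusterFlip_of_not_qtouch ends a _ (fun h' => h (hq.2 h'))]
    simp only [Bool.not_not, hagree l hl]

include hN1 hN2 hzn hzn0 hzr in
/-- **The flat on a NETWORK label**: for an apex `a ∉ Nv`, `♭ₐz` complements the network label `l` iff `l` touches the `zn`-cluster of a port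
that is joined to `a` in `z`. [this work] -/
theorem qtouch_net_iff {a : V} (ha : a ∉ Nv) {l : α} (hl : inN l) :
    QTouch ends a (fun x => !z x) l ↔
      ∃ t, (t = p ∨ t = q) ∧ (openGraph (labelledOpen ends z)).Reachable a t ∧
        ∃ v ∈ ends l, (openGraph (labelledOpen ends zn)).Reachable t v := by
  rw [qtouch_compl_iff]
  constructor
  · rintro ⟨v, hv, hr⟩
    by_cases hvN : v ∈ Nv
    · obtain ⟨t, ht, h1, h2⟩ := (reachable_into_iff ends p q Nv inN hN1 hN2 hzn hzn0 hzr ha hvN).1 hr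
      exact ⟨t, ht, h1, v, hv, h2⟩
    · have hvp : v = p ∨ v = q := by
        rcases hN1 l hl v hv with h | h
        · exact absurd h hvN
        · exact h
      exact ⟨v, hvp, hr, v, hv, SimpleGraph.Reachable.refl _⟩
  · rintro ⟨t, -, h1, v, hv, h2⟩
    exact ⟨v, hv, h1.trans (reachable_of_reachable_net ends inN hzn hzn0 h2)⟩

include hN1 hN2 hzn hzn0 hzr in
/-- The flat keeps a network label untouched by the clusters of the ports joined to the apex… [this work] -/
theorem flat_apply_net_of_not {a : V} (ha : a ∉ Nv) {l : α} (hl : inN l)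
    (h : ¬ ∃ t, (t = p ∨ t = q) ∧ (openGraph (labelledOpen ends z)).Reachable a t ∧
        ∃ v ∈ ends l, (openGraph (labelledOpen ends zn)).Reachable t v) :
    clusterFlip ends a (fun x => !z x) l = z l := by
  classical
  rw [clusterFlip_of_not_qtouch ends a _
    (fun h' => h ((qtouch_net_iff ends p q Nv inN hN1 hN2 hzn hzn0 hzr ha hl).1 h')), Bool.not_not]

include hN1 hN2 hzn hzn0 hzr in
/-- … and complements a network label touching such a cluster. [this work] -/
theorem flat_apply_net_of {a : V} (ha : a ∉ Nv) {l : α} (hl : inN l)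
    (h : ∃ t, (t = p ∨ t = q) ∧ (openGraph (labelledOpen ends z)).Reachable a t ∧
        ∃ v ∈ ends l, (openGraph (labelledOpen ends zn)).Reachable t v) :
    clusterFlip ends a (fun x => !z x) l = !z l := by
  classical
  rw [clusterFlip_of_qtouch ends a _ ((qtouch_net_iff ends p q Nv inN hN1 hN2 hzn hzn0 hzr ha hl).2 h)]

end TwoPort

end Summit.CriticalPhenomena.PercolationContinuityZ3.Theorems.ProductFormFibre
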